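import Mathlib
import Summits.ResolutionOfSingularities.ResolutionOfSingularities.Theorems.RadicialJungCleanModelsCleanProp44TauTwoRegime
import HarnessLib

/-!
# Route `RadicialJung`, crux `CleanModels` (stmt-ResolutionOfSingularities-15917), line `Sketch` rev 35, stub 6 `stub_cleanProp44` (X44c):
# `τ = 1` points come from `τ = 1` points — the `τ = 1` locus does not spread along clean-permissible sequences

Seat decomp-res-hand-2 g15 (structural hand).  POINTWISE sharpening of ✓ `IsCleanPermissibleSeq.two_le_stalkTau_of_forall`
(`…CleanProp44TauTwoRegime.lean`: the `τ ≥ 2` regime is stable): along any clean-permissible sequence `π : X' → X` for `(J, μ)` over a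
regular quasi-excellent Noetherian threefold, **every closed threefold point `x'` of the new `μ`-stratum with Hironaka `τ_{x'} = 1` lies
over a closed threefold point `π x'` of the old `μ`-stratum with `τ_{π x'} = 1`** (`IsCleanPermissibleSeq.stalkTau_eq_one_image`).  One step
([CoP1] Lemma 4.3): off the centre the local ring does not change (✓ `IsBlowup.stalkTau_controlledTransform_of_not_mem`); over a POINT centre a
near point of a `τ ≥ 2` point has `τ ≥ 2` (4.3 (1) ✓ `IsBlowup.stalkTau_le_two_of_isNear_point`, 4.3 (3) ✓
`IsBlowup.stalkTau_le_stalkTau_of_isNear_point`); over a CURVE centre through a `τ ≥ 2` point there is no near point (4.3 (2) ✓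
`IsBlowup.not_isNear_of_two_le_stalkTau`); `τ ≥ 1` on the stratum (✓ `one_le_stalkTau`).  So the `τ = 1` part of the residual of stub 6
((R1)–(R3) of ✓ `cleanProp44_of_tauOneResidual`) is generated, stage after stage, by the `τ = 1` points of the INITIAL stage: the births of
memo 4e §2.4–2.6 happen over `τ = 1` points only.

* `IsCleanPermissibleSeq.stalkTau_eq_one_image` — the pointwise statement;
* `IsCleanPermissibleSeq.two_le_stalkTau_of_forall'` — the regime lemma of ✓ `…TauTwoRegime.lean` re-derived from it (sanity check).

Honest framing: OURS; nothing here proves X44c, any case of `CleanModels`, or resolution of singularities in characteristic `p`.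
[cite: CossartPiltant2008, Lemma 4.3 (1) (2) (3); Prop. 4.2 (b)]
-/

noncomputable section

set_option linter.dupNamespace false -- mandated namespace of this single-conjunct summit

open CategoryTheory CategoryTheory.Limits AlgebraicGeometry TopologicalSpace IsLocalRing
open Literature.AlgebraicGeometry.Resolution Literature.AlgebraicGeometry.Motives
open Scheme.IdealSheafData
open Summit.ResolutionOfSingularities.ResolutionOfSingularities.Theorems.CP2008Prop44

namespace Summit.ResolutionOfSingularities.ResolutionOfSingularities.Theorems.RadicialJung.CleanModels

/-- For a point with regular local ring: embedding dimension `3` iff coheight `3`. [folklore] -/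
private theorem spanFinrank_eq_three_iff_coheight_eq_three {X : Scheme.{0}} (x : X) [IsRegularLocalRing (X.presheaf.stalk x)] :
    (maximalIdeal (X.presheaf.stalk x)).spanFinrank = 3 ↔ Order.coheight x = 3 := by
  have h := CampaignW46.coheight_eq_spanFinrank x
  constructor
  · intro hd
    rw [h, hd]
    rfl
  · intro hc
    rw [hc] at h
    exact_mod_cast h.symm

set_option maxHeartbeats 800000 in
-- near-point bookkeeping at each step of the induction
/-- **`τ = 1` points come from `τ = 1` points.**  Let `X` be integral Noetherian regular quasi-excellent of dimension `≤ 3`, `(J, μ)` with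
`μ ≥ 1`, `ord ≤ μ`, `V(J)` of codimension `≥ 2`, and `π : X' → X` a clean-permissible sequence for `(J, μ)` with transform `J'`.  If `x'` is a
CLOSED point of `X'` with `ord_{x'} J' = μ`, embedding dimension `3` and `τ_{x'}(J', μ) = 1`, then `π x'` is a closed point of `X` with
`ord J = μ`, embedding dimension `3` and `τ_{π x'}(J, μ) = 1`. [cite: CossartPiltant2008, Lemma 4.3 (1) (2) (3); Prop. 4.2 (b)] -/
theorem IsCleanPermissibleSeq.stalkTau_eq_one_image {p : ℕ} {X' X : Scheme.{0}} [IsIntegral X'] [IsIntegral X]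
    {π : X' ⟶ X} [IsDominant π] {J : X.IdealSheafData} {μ : ℕ} {J' : X'.IdealSheafData} {G : X.functionField}
    (h : IsCleanPermissibleSeq p π J μ J' G) :
    IsNoetherian X → Scheme.IsRegular X → Scheme.IsQuasiExcellent X → topologicalKrullDim X ≤ 3 → 1 ≤ μ →
      (∀ x, idealOrder J x ≤ μ) → (∀ x ∈ J.support, 1 < Order.coheight x) →
      ∀ x' : X', IsClosed ({x'} : Set X') → idealOrder J' x' = μ → (maximalIdeal (X'.presheaf.stalk x')).spanFinrank = 3 →
        (∀ hr : IsRegularLocalRing (X'.presheaf.stalk x'), @stalkTau X' J' x' hr μ = 1) →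
        IsClosed ({π x'} : Set X) ∧ idealOrder J (π x') = μ ∧ (maximalIdeal (X.presheaf.stalk (π x'))).spanFinrank = 3 ∧
          ∀ hr : IsRegularLocalRing (X.presheaf.stalk (π x')), @stalkTau X J (π x') hr μ = 1 := by
  induction h with
  | nil J μ G =>
    intro _ _ _ _ _ _ _ x' hcl hord hd hτ
    exact ⟨hcl, hord, hd, hτ⟩
  | @cons X'' X' X _ _ _ τ _ π _ J μ J' G Y hπ hint hreg hY hτ hperm ih =>
    intro hN hX hqe hX3 hμ hle hcodim x'' hx''cl hord'' hd'' hτ1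
    haveI := hN
    have IH := ih hN hX hqe hX3 hμ hle hcodim
    -- the invariants at the intermediate stage `X'`
    obtain ⟨-, hnoeth', hX', -, -, hcodim'⟩ :=
      IsPermissibleBlowupSeq.prop44Invariants hX hqe hμ hle hcodim (isPermissibleBlowupSeq_of_isPermissibleSeq hπ.isPermissibleSeq)
    haveI := hnoeth'
    have hX3' : topologicalKrullDim X' ≤ 3 :=
      (isPermissibleBlowupSeq_of_isPermissibleSeq hπ.isPermissibleSeq).topologicalKrullDim_le inferInstance hX3
    have hcoh3' : ∀ z : X', Order.coheight z ≤ 3 := (topologicalKrullDim_le_iff_forall_coheight_le X' 3).mp hX3'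
    haveI : IsProper τ := hτ.isProper
    haveI : IsLocallyNoetherian X'' := hτ.isLocallyNoetherian
    haveI hry : IsRegularLocalRing (X'.presheaf.stalk (τ x'')) := hX' (τ x'')
    haveI hrx : IsRegularLocalRing (X''.presheaf.stalk x'') := (hτ.isRegular_of_isRegular_subscheme hX' hreg) x''
    -- the image point `τ x''` is closed, of embedding dimension `3`
    have hycl : IsClosed ({τ x''} : Set X') := by
      have := τ.isClosedMap _ hx''cl
      rwa [Set.image_singleton] at this
    have hcohx'' : Order.coheight x'' = 3 := (spanFinrank_eq_three_iff_coheight_eq_three x'').mp hd''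
    have hcohy : Order.coheight (τ x'') = 3 := le_antisymm (hcoh3' _) (hcohx'' ▸ hτ.coheight_le x'')
    have hdy : (maximalIdeal (X'.presheaf.stalk (τ x''))).spanFinrank = 3 :=
      (spanFinrank_eq_three_iff_coheight_eq_three _).mpr hcohy
    -- it is a point of the stratum with `τ = 1`
    have step : idealOrder J' (τ x'') = μ ∧ stalkTau J' (τ x'') μ = 1 := by
      by_cases hmem : τ x'' ∈ (Y : Set X')
      · -- over the centre
        have hnear : IsNear τ (vanishingIdeal Y) J' μ x'' := isNear_iff.mpr hord''
        have hordy : idealOrder J' (τ x'') = μ := hY _ hmem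
        refine ⟨hordy, le_antisymm ?_ (one_le_stalkTau J' (τ x'') hμ hordy)⟩
        by_contra hτy
        rw [not_le] at hτy
        have hτy2 : 2 ≤ stalkTau J' (τ x'') μ := hτy
        -- the generic point of the (irreducible) centre
        have hirr : IsIrreducible (Y : Set X') := isIrreducible_of_isIntegral_subscheme_vanishingIdeal Y hint
        obtain ⟨η, hη⟩ := QuasiSober.sober hirr Y.isClosed
        have hYeq : (Y : Set X') = closure {η} := (isGenericPoint_def.mp hη).symm
        have hηY : η ∈ (Y : Set X') := hη.mem
        by_cases hηy : η = τ x''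
        · -- POINT centre: the near point `x''` has `τ ≥ 2` (Lemma 4.3 (1), (3)) — contradiction with `τ_{x''} = 1`
          have hYpt : (Y : Set X') = {τ x''} := by rw [hYeq, hηy, hycl.closure_eq]
          have hYc : Y = ⟨{τ x''}, hycl⟩ := Closeds.ext hYpt
          obtain ⟨c3, hc3, hc3Y⟩ := CampaignW46.exists_rsop_three hycl hdy
          rw [← hYc] at hc3Y
          have hle2 : stalkTau J' (τ x'') μ ≤ 2 := hτ.stalkTau_le_two_of_isNear_point hdy hc3 hc3Y hnear
          have hτyeq : stalkTau J' (τ x'') μ = 2 := le_antisymm hle2 hτy2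
          have hmono := hτ.stalkTau_le_stalkTau_of_isNear_point hμ hdy hc3 hc3Y hτyeq hnear
          rw [hτyeq, hτ1 hrx] at hmono
          exact absurd hmono (by decide)
        · -- CURVE centre through a `τ ≥ 2` point: no near point (Lemma 4.3 (2))
          have hηy' : η ⤳ τ x'' := specializes_iff_mem_closure.mpr (hYeq ▸ hmem)
          have hyη : ¬ τ x'' ⤳ η := fun h' => hηy (hηy'.antisymm h').eq
          have hηsupp : η ∈ J'.support := by
            rw [← one_le_idealOrder_iff, hY η hηY]
            exact_mod_cast hμ
          have h1 : 1 < Order.coheight η := hcodim' η hηsupp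
          obtain ⟨c, hcr, hcY⟩ := exists_isRsopPart_fin_two_of_specializes hreg hYeq hηy' hyη h1 (hcoh3' _)
          exact hτ.not_isNear_of_two_le_stalkTau hX' hreg hμ hY hcr hcY hτy2 hnear
      · -- off the centre
        have hnot : τ x'' ∉ ((vanishingIdeal Y).support : Set X') := by
          rwa [Scheme.IdealSheafData.coe_support_vanishingIdeal]
        have hτeq := hτ.stalkTau_controlledTransform_of_not_mem J' μ μ hnot (x' := x'')
        have hordeq := hτ.idealOrder_controlledTransform_of_not_mem J' μ hnot
        refine ⟨?_, ?_⟩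
        · rw [← hordeq]; exact hord''
        · rw [← hτeq]; exact hτ1 hrx
    obtain ⟨hordy, hτy⟩ := step
    -- conclude by induction at `π (τ x'')`
    exact IH (τ x'') hycl hordy hdy (fun hr => hτy)

/-- The `τ ≥ 2` regime lemma ✓ `IsCleanPermissibleSeq.two_le_stalkTau_of_forall` RE-DERIVED from the pointwise statement (sanity check of the
sharpening). [cite: CossartPiltant2008, Lemma 4.3] -/
theorem IsCleanPermissibleSeq.two_le_stalkTau_of_forall' {p : ℕ} {X' X : Scheme.{0}} [IsIntegral X'] [IsIntegral X]
    {π : X' ⟶ X} [IsDominant π] {J : X.IdealSheafData} {μ : ℕ} {J' : X'.IdealSheafData} {G : X.functionField}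
    (h : IsCleanPermissibleSeq p π J μ J' G) (hN : IsNoetherian X) (hX : Scheme.IsRegular X) (hqe : Scheme.IsQuasiExcellent X)
    (hX3 : topologicalKrullDim X ≤ 3) (hμ : 1 ≤ μ) (hle : ∀ x, idealOrder J x ≤ μ) (hcodim : ∀ x ∈ J.support, 1 < Order.coheight x)
    (hτ2 : ∀ x : X, IsClosed ({x} : Set X) → idealOrder J x = μ → (maximalIdeal (X.presheaf.stalk x)).spanFinrank = 3 →
      ∀ hr : IsRegularLocalRing (X.presheaf.stalk x), 2 ≤ @stalkTau X J x hr μ)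
    (x' : X') (hcl : IsClosed ({x'} : Set X')) (hord : idealOrder J' x' = μ)
    (hd : (maximalIdeal (X'.presheaf.stalk x')).spanFinrank = 3) (hr : IsRegularLocalRing (X'.presheaf.stalk x')) :
    2 ≤ @stalkTau X' J' x' hr μ := by
  by_contra hlt
  rw [not_le] at hlt
  have h1 : 1 ≤ @stalkTau X' J' x' hr μ := one_le_stalkTau J' x' hμ hord
  have heq : @stalkTau X' J' x' hr μ = 1 := by omega
  have hτ1 : ∀ hr' : IsRegularLocalRing (X'.presheaf.stalk x'), @stalkTau X' J' x' hr' μ = 1 := fun hr' => heq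
  obtain ⟨hycl, hordy, hdy, hτy⟩ := h.stalkTau_eq_one_image hN hX hqe hX3 hμ hle hcodim x' hcl hord hd hτ1
  haveI := hX (π x')
  have h2 := hτ2 (π x') hycl hordy hdy (hX (π x'))
  have h3 := hτy (hX (π x'))
  omega

end Summit.ResolutionOfSingularities.ResolutionOfSingularities.Theorems.RadicialJung.CleanModels

end
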